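import Literature.NumberTheory.Automorphic.UnitaryThreeBlockCentralizer      -- ★ γ2a p841185 (+ ★ B-p04 p841018, ★ (F1) B-p17)
import Literature.NumberTheory.Automorphic.UnitaryTwoSplitDictionary          -- ★ γ0 p841015: `rel_of_fixed_coords`
import HarnessLib

/-!
# Block elements of `U(σ, Φ₃)` from the four corner relations; the torus elements `τ(z) ∈ T_H^θ = Z_H(t_θ)`
(Flicker (1998), *Elementary proof of the fundamental lemma for a unitary group*, Prop. 6 p. 83: `T_H^θ = D₁⁻¹ T₂^θ D₁ × E¹`, `T₂^θ = {ε(u, vθD; v∕θ, u)}`)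

Topic `NumberTheory/Automorphic`; namespace `Literature.NumberTheory.Automorphic.UnitaryGroup`.  KERNEL mathematics only: theorems, no definition, no
named fact, no instance, no notation, no `sorry`.  Cell `pub/hodgecm-mathlib`, programme P3a, road «D-N7-inert», MAP v3 «N7-ns COUNT FROM FLICKER», brick
(F3c-γ) «LATTICE ↔ COSET TRANSPORT» FILE γ2b-A (LEAD F0P3a-plan (g9) T8-60 (C); architect A-p06 (g26); consumer B-p04 (g33) ★ p840967 `hA`∕`hB`).
HC_CM is proved only modulo the printed citations (2 remaining named inputs hLiu418, h413) until rung 0 closes; this file discharges no named fact.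

MATHEMATICS (`K` a field with involution `σ`, `Φ₃ = antidiag(1,1,1)`).  §1 THE BLOCK CONSTRUCTOR (converse of ★ `block_relations_of_coe_eq` ∕ ★
`SplitDictionary.rel_of_coe_eq_block`): if `(α β; γ δ)` satisfies the four `antidiag(1,1)`-relations and `σe·e = 1` then `!![α,0,β;0,e,0;γ,0,δ] ∈ U(σ,Φ₃)`
(so it lies in `H`).  §2 THE TORUS ELEMENTS: for `σ`-fixed `u, v, θ` with `θ` a unit and `d` with `σd = −d ≠ 0`, `z := u + v d ≠ 0`:
**`τ(z) := z⁻¹ · !![u, 0, vdθ; 0, z, 0; vd∕θ, 0, u] ∈ U(σ, Φ₃)`** (γ0's converse at `λ = z⁻¹`, `g = diag(θ,1)·ι_d(z)·diag(θ,1)⁻¹`, `N(z) = u² − v²d² = det ι_d(z)`),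
an element of `H` whose corner has equal diagonal entries and `β·(vd∕θ)… ` — i.e. of `Z_H(t_θ)` for every regular `t_θ` of F0P3-p02's torus
(★ `mem_centralizer_block_iff`: `α = δ`, `β·C = B·γ` with `B∕C = θ²`).

References: [Flicker1998UnitaryFL] Y. Z. Flicker, Canad. J. Math. 50 (1998), Prop. 6 p. 83 · [Rogawski1990] J. D. Rogawski, Ann. of Math. Stud. 123, §4.9 p. 55. -/

set_option autoImplicit false

open Matrix
open scoped MatrixGroups

namespace Literature.NumberTheory.Automorphic.UnitaryGroup

variable {K : Type*} [Field K] (σ : K →+* K) {J : Matrix (Fin 3) (Fin 3) K} (hJ : J = (StdForm.antidiagonal 3).over K)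

/-! ## §1 The block constructor -/

include hJ in
/-- **BLOCK CONSTRUCTOR**: the four corner relations (R1)–(R4) and `σe·e = 1` put `!![α,0,β;0,e,0;γ,0,δ]` in `U(σ, Φ₃)` (converse of ★
`SplitDictionary.rel_of_coe_eq_block`). [cite: Flicker1998UnitaryFL, Prop. 4 p. 81; Prop. 6 p. 83] -/
theorem exists_coe_eq_block_of_rel {α β γ δ e : K}
    (R1 : σ α * γ + σ γ * α = 0) (R2 : σ α * δ + σ γ * β = 1) (R3 : σ β * γ + σ δ * α = 1) (R4 : σ β * δ + σ δ * β = 0) (he : σ e * e = 1) :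
    ∃ h : ↥(unitaryGroupOfForm σ J), ((h : GL (Fin 3) K) : Matrix (Fin 3) (Fin 3) K) = !![α, 0, β; 0, e, 0; γ, 0, δ] := by
  have hΔ : α * δ - β * γ ≠ 0 := SplitDictionary.det_ne_zero σ R1 R2
  have he0 : e ≠ 0 := fun h0 => by rw [h0, mul_zero] at he; exact zero_ne_one he
  have hdet : (!![α, 0, β; 0, e, 0; γ, 0, δ] : Matrix (Fin 3) (Fin 3) K).det ≠ 0 := by
    have : (!![α, 0, β; 0, e, 0; γ, 0, δ] : Matrix (Fin 3) (Fin 3) K).det = e * (α * δ - β * γ) := by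
      rw [Matrix.det_fin_three]; simp; ring
    rw [this]; exact mul_ne_zero he0 hΔ
  have r0 : Fin.rev (0 : Fin 3) = 2 := rfl
  have r1 : Fin.rev (1 : Fin 3) = 1 := rfl
  have r2 : Fin.rev (2 : Fin 3) = 0 := rfl
  have hmem : Matrix.GeneralLinearGroup.mkOfDetNeZero _ hdet ∈ unitaryGroupOfForm σ J := by
    rw [hJ, mem_unitaryGroupOfForm_antidiagonal_iff_sum']
    intro a b
    fin_cases a <;> fin_cases b <;>
      simp [Matrix.GeneralLinearGroup.val_mkOfDetNeZero, Fin.sum_univ_three, r0, r1, r2] <;>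
      first | linear_combination R1 | linear_combination R2 | linear_combination R3 | linear_combination R4 | linear_combination he
  exact ⟨⟨_, hmem⟩, Matrix.GeneralLinearGroup.val_mkOfDetNeZero _ _⟩

/-! ## §2 The torus elements `τ(z)` -/

include hJ in
/-- **THE TORUS ELEMENT `τ(z)`**: for `σ`-fixed `u v θ` (`θ θ′ = 1`), `σd = −d`, `d ≠ 0`, and `z := u + v·d ≠ 0`, the block matrix
`!![u∕z, 0, v d θ∕z; 0, 1, 0; v d θ′∕z, 0, u∕z]` is an element of `U(σ, Φ₃)` — γ0's dictionary at `λ = z⁻¹`, `g = diag(θ,1) ι_d(z) diag(θ,1)⁻¹`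
(`det = N(z)∕z² `, `N(z) = u² − v²d²`); it is Flicker's `D₁⁻¹ (u, vθD; v∕θ, u) D₁ ∕ z`. [cite: Flicker1998UnitaryFL, Prop. 6 p. 83] -/
theorem exists_coe_eq_torusBlock (hσσ : ∀ x, σ (σ x) = x) {d : K} (hd : σ d = -d) (hd0 : d ≠ 0) {u v θ θ' : K}
    (hu : σ u = u) (hv : σ v = v) (hσθ : σ θ = θ) (hσθ' : σ θ' = θ') (hθ : θ * θ' = 1) (hz : u + v * d ≠ 0) :
    ∃ τ : ↥(unitaryGroupOfForm σ J), ((τ : GL (Fin 3) K) : Matrix (Fin 3) (Fin 3) K) =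
      !![u / (u + v * d), 0, v * d * θ / (u + v * d); 0, 1, 0; v * d * θ' / (u + v * d), 0, u / (u + v * d)] := by
  -- γ0's converse with `l := (u + v d)⁻¹`, `a := u`, `b := v d² θ`, `c := v θ′`, `e := u`
  have hθ0 : θ ≠ 0 := fun h0 => by rw [h0, zero_mul] at hθ; exact zero_ne_one hθ
  have hσz : σ (u + v * d) = u - v * d := by rw [map_add, map_mul, hu, hv, hd]; ring
  have hσz0 : u - v * d ≠ 0 := by
    intro h0; apply hz
    have : σ (σ (u + v * d)) = σ 0 := by rw [hσz, h0]
    rwa [hσσ, map_zero] at this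
  have hN : (u + v * d)⁻¹ * σ (u + v * d)⁻¹ * (u * u - v * (d * d) * θ * (v * θ')) = 1 := by
    rw [map_inv₀, hσz]
    have : u * u - v * (d * d) * θ * (v * θ') = (u + v * d) * (u - v * d) := by
      linear_combination (-(v * v * d * d)) * hθ
    rw [this]; field_simp
  obtain ⟨R1, R2, R3, R4⟩ := SplitDictionary.rel_of_fixed_coords σ hd hd0 (a := u) (b := v * (d * d) * θ) (c := v * θ') (e := u)
    (l := (u + v * d)⁻¹) hu (by rw [map_mul, map_mul, map_mul, hv, hd, hσθ]; ring) (by rw [map_mul, hv, hσθ']) hu hN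
  obtain ⟨τ, hτ⟩ := exists_coe_eq_block_of_rel σ hJ R1 R2 R3 R4 (e := 1) (by rw [map_one, mul_one])
  refine ⟨τ, ?_⟩
  rw [hτ]
  have e1 : (u + v * d)⁻¹ * u = u / (u + v * d) := by rw [inv_mul_eq_div]
  have e2 : (u + v * d)⁻¹ * (v * (d * d) * θ) / d = v * d * θ / (u + v * d) := by field_simp
  have e3 : (u + v * d)⁻¹ * (v * θ') * d = v * d * θ' / (u + v * d) := by field_simp
  rw [e1, e2, e3]

/-- **`τ(z) ∈ Z_H(t)` for every regular torus block `t = !![A,0,B;0,b,0;C,0,A]` with `B·θ′ = C·θ`** (`C ≠ 0`; for F0P3-p02's `t_θ`: `B = −e(a₀−c₀)θ`,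
`C = −e(a₀−c₀)θ′`): the corner of `τ(z)` has equal diagonal entries and `β·C = B·γ`. [cite: Flicker1998UnitaryFL, Prop. 6 p. 83] -/
theorem torusBlock_mem_centralizer {τ t : ↥(unitaryGroupOfForm σ J)} {d u v θ θ' A B C b : K}
    (hτ : ((τ : GL (Fin 3) K) : Matrix (Fin 3) (Fin 3) K) =
      !![u / (u + v * d), 0, v * d * θ / (u + v * d); 0, 1, 0; v * d * θ' / (u + v * d), 0, u / (u + v * d)])
    (ht : ((t : GL (Fin 3) K) : Matrix (Fin 3) (Fin 3) K) = !![A, 0, B; 0, b, 0; C, 0, A]) (hC : C ≠ 0) (hBC : B * θ' = C * θ) :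
    τ ∈ Subgroup.centralizer ({t} : Set ↥(unitaryGroupOfForm σ J)) := by
  rw [mem_centralizer_block_iff σ hτ ht hC]
  refine ⟨rfl, ?_⟩
  by_cases hz : u + v * d = 0
  · simp [hz]
  · field_simp
    linear_combination (-(v * d)) * hBC

/-! ## §3 (ED. 2) The radial representatives `r_i = diag(ϖ^{−i}, 1, ϖ^{i}) ∈ H` -/

include hJ in
/-- **The radial representatives as a function `r : ℕ → ↥H`**: for `σϖ = ϖ ≠ 0` there is `r : ℕ → Z_U(c)` (`c = diag(1,−1,1)`) with
`↑↑↑(r i) = !![(ϖ^i)⁻¹, 0, 0; 0, 1, 0; 0, 0, ϖ^i]` (F0P3-p02's ★ `diagRadial`; the `r` of ★ `FixedPointsTorusDoubleCosetCount` in the `U(Φ₃)` frame).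
[cite: Flicker1998UnitaryFL, Prop. 6 p. 83] -/
theorem exists_diagRadial {ϖ : K} (hϖσ : σ ϖ = ϖ) (hϖ0 : ϖ ≠ 0)
    {c : ↥(unitaryGroupOfForm σ J)} (hc : ((c : GL (Fin 3) K) : Matrix (Fin 3) (Fin 3) K) = !![1, 0, 0; 0, -1, 0; 0, 0, 1]) :
    ∃ r : ℕ → ↥(Subgroup.centralizer ({c} : Set ↥(unitaryGroupOfForm σ J))),
      ∀ i, (((r i : ↥(unitaryGroupOfForm σ J)) : GL (Fin 3) K) : Matrix (Fin 3) (Fin 3) K) = !![(ϖ ^ i)⁻¹, 0, 0; 0, 1, 0; 0, 0, ϖ ^ i] := by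
  have key : ∀ i : ℕ, ∃ ri : ↥(Subgroup.centralizer ({c} : Set ↥(unitaryGroupOfForm σ J))),
      (((ri : ↥(unitaryGroupOfForm σ J)) : GL (Fin 3) K) : Matrix (Fin 3) (Fin 3) K) = !![(ϖ ^ i)⁻¹, 0, 0; 0, 1, 0; 0, 0, ϖ ^ i] := by
    intro i
    have hϖi : σ (ϖ ^ i) = ϖ ^ i := by rw [map_pow, hϖσ]
    have hϖi' : σ ((ϖ ^ i)⁻¹) = (ϖ ^ i)⁻¹ := by rw [map_inv₀, hϖi]
    have hi0 : ϖ ^ i ≠ 0 := pow_ne_zero _ hϖ0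
    obtain ⟨h, hh⟩ := exists_coe_eq_block_of_rel σ hJ (α := (ϖ ^ i)⁻¹) (β := 0) (γ := 0) (δ := ϖ ^ i) (e := 1)
      (by rw [map_zero]; ring) (by rw [hϖi', map_zero, inv_mul_cancel₀ hi0]; ring) (by rw [map_zero, hϖi, mul_inv_cancel₀ hi0]; ring)
      (by rw [map_zero, hϖi]; ring) (by rw [map_one, mul_one])
    exact ⟨⟨h, mem_centralizer_of_coe_eq_block σ hc hh⟩, hh⟩
  choose r hr using key
  exact ⟨r, hr⟩

end Literature.NumberTheory.Automorphic.UnitaryGroup
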